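import Summits.ResolutionOfSingularities.ResolutionOfSingularities.Theorems.WildConesCampaignW46HypersurfacesCharTwoDegFormCalculus
import Summits.ResolutionOfSingularities.ResolutionOfSingularities.Theorems.WildConesCampaignW46HypersurfacesCharTwoHilbertDefs
import Mathlib.LinearAlgebra.Dimension.OrzechProperty

/-!
# [OURS · L1 W4.6, rung (ii) at p = 2, EVERY dimension n] SIX CLASSES: at corank two the classes of
# `1, x, y, x², xy, y²` span `κ⟦X⟧/((∂f) + 𝔪³)` for two linear forms `x, y`, and when that space has
# dimension six (`h₂ = 3`) every directional derivative `Σ λₛ ∂ₛ f` along a kernel vector of the polar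
# form lies in `𝔪·(∂f) + 𝔪³` — the commutative algebra behind the link `h₂ = 3 ⇒ tangent cubic ≡ 0 on ker P`

HONEST FRAMING. Everything here is OURS: commutative algebra in `R = κ⟦X₁,…,Xₙ⟧` about the gradient ideal
`J = (∂f)` and the maximal ideal `𝔪`, stated with the seat's invariants `jetTwoColength` (p498937) and
`jetThreeColength` (p511581) and its `polarMatrix` (p502936); used by the companion file
`…HypersurfacesCharTwoTangentCubicKernel.lean` on route WildCones' point-blow-up dynamics
(`Theorems/WildConesClassicalRegimesDefs.lean`). NOTHING here is a statement of the manuscript [Hironaka2017];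
no FACT-LIST premise; AI review is weaker than expert review. Cell res-hironaka (LADDER-RESOLUTION rung L,
D-0089), slot W4.6, seat res-L1-s46-pv-4 (gen 5); host route `WildCones`, crux `ClassicalRegimes`
(stmt-ResolutionOfSingularities-16884; proved).

THE ARGUMENT. `jetTwoColength f = 3` (`e = 2`) means `dim R/(J+𝔪²) = 3`: the classes of the variables
span a proper subspace (it misses `[1]`), of dimension `≤ 2`, so two LINEAR FORMS `x, y` generate `𝔪`
modulo `J + 𝔪²` (`exists_linear_pair_of_jetTwoColength_eq_three`). Then `x², xy, y²` generate `𝔪² = 𝔪·𝔪`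
modulo `𝔪J + 𝔪³` (`exists_quadratic_coeffs`: for `m = ℓ + r`, `m' = ℓ' + r'`,
`mm' − ℓℓ' = r m' + ℓ r' ∈ 𝔪J + 𝔪³`), and `1, x, y, x², xy, y²` span `R/(J+𝔪³)` (`top_le_span_six`).
If `jetThreeColength f = 6` the six classes are INDEPENDENT, so an element of `J ∩ 𝔪²`, which is
`≡ αx² + βxy + γy²` modulo `𝔪J + 𝔪³ ⊆ J + 𝔪³`, has `α = β = γ = 0` and lies in `𝔪J + 𝔪³`
(`mem_maximalIdeal_mul_jac_of_jetThree_eq_six`); in particular the directional derivatives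
`Σ λₛ ∂ₛ f` along kernel vectors `λ` of the polar form (`sum_C_mul_pderiv_mem_of_jetThree_eq_six`).

References: folklore (Nakayama-type bookkeeping of `𝔪`-adic jets); H. Hironaka, ms. 2017 [Hironaka2017] —
none of it used.
-/

noncomputable section

-- single-problem summit: the doubled namespace component `ResolutionOfSingularities` is forced
set_option linter.dupNamespace false

open scoped BigOperators Classical

open MvPowerSeries IsLocalRing

open Literature.AlgebraicGeometry.Resolution

namespace Summit.ResolutionOfSingularities.ResolutionOfSingularities.Theorems

namespace CampaignW46.HypersurfacesCharTwo

open WildCones WildCones.MuDropCharTwoOrdP ThreefoldsCharTwo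

variable {κ : Type} [Field κ] {n : ℕ}

/-! ## Linear algebra: a spanning pair in dimension `≤ 2` -/

/-- [OURS · L1 W4.6] A subspace of dimension `≤ 2` is spanned by two of its vectors. [folklore] -/
theorem exists_pair_span_of_finrank_le_two {V : Type} [AddCommGroup V] [Module κ V] (U : Submodule κ V)
    [FiniteDimensional κ U] (h : Module.finrank κ U ≤ 2) :
    ∃ x ∈ U, ∃ y ∈ U, ∀ u ∈ U, ∃ α β : κ, u = α • x + β • y := by
  obtain ⟨k, hk⟩ : ∃ k, Module.finrank κ U = k := ⟨_, rfl⟩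
  have hk2 : k ≤ 2 := hk ▸ h
  interval_cases k
  · have hbot : U = ⊥ := Submodule.finrank_eq_zero.mp hk
    refine ⟨0, U.zero_mem, 0, U.zero_mem, fun u hu => ⟨0, 0, ?_⟩⟩
    rw [hbot, Submodule.mem_bot] at hu
    rw [hu, zero_smul, add_zero]
  · set b := Module.finBasisOfFinrankEq κ U hk with hb
    refine ⟨(b 0 : V), (b 0).2, 0, U.zero_mem, fun u hu => ⟨b.repr ⟨u, hu⟩ 0, 0, ?_⟩⟩
    have h1 := congrArg Subtype.val (b.sum_repr ⟨u, hu⟩)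
    rw [Fin.sum_univ_one, Submodule.coe_smul] at h1
    rw [zero_smul, add_zero, h1]
  · set b := Module.finBasisOfFinrankEq κ U hk with hb
    refine ⟨(b 0 : V), (b 0).2, (b 1 : V), (b 1).2, fun u hu => ⟨b.repr ⟨u, hu⟩ 0, b.repr ⟨u, hu⟩ 1, ?_⟩⟩
    have h1 := congrArg Subtype.val (b.sum_repr ⟨u, hu⟩)
    rw [Fin.sum_univ_two, Submodule.coe_add, Submodule.coe_smul, Submodule.coe_smul] at h1
    rw [h1]

/-- [OURS · L1 W4.6] Scalars through a quotient map: `[C a · g] = a • [g]`. [folklore] -/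
theorem mk_C_mul (I : Ideal (MvPowerSeries (Fin n) κ)) (a : κ) (g : MvPowerSeries (Fin n) κ) :
    Ideal.Quotient.mk I (C a * g) = a • Ideal.Quotient.mk I g := by
  rw [map_mul, MvPowerSeries.c_eq_algebraMap, Ideal.Quotient.mk_algebraMap, ← Algebra.smul_def]

/-- [OURS · L1 W4.6] A linear form `Σ aₛ Xₛ` lies in the maximal ideal. [folklore] -/
theorem sum_C_mul_X_mem_maximalIdeal (a : Fin n → κ) :
    ∑ s, C (a s) * (X s : MvPowerSeries (Fin n) κ) ∈ maximalIdeal (MvPowerSeries (Fin n) κ) :=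
  Ideal.sum_mem _ fun s _ => Ideal.mul_mem_left _ _
    (Literature.RingTheory.MvPowerSeries.Jets.mem_maximalIdeal_iff_constantCoeff_eq_zero.mpr
      (constantCoeff_X s))

/-- [OURS · L1 W4.6] The partials of a series without linear terms lie in `𝔪`, so `(∂f) + 𝔪^k ≤ 𝔪`
(`k ≠ 0`). [folklore] -/
theorem jac_sup_pow_le_maximalIdeal {f : MvPowerSeries (Fin n) κ}
    (hf : ∀ s, coeff (Finsupp.single s 1) f = 0) {k : ℕ} (hk : k ≠ 0) :
    Ideal.span (Set.range fun s => MvPowerSeries.pderiv s f) ⊔ maximalIdeal (MvPowerSeries (Fin n) κ) ^ k ≤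
      maximalIdeal (MvPowerSeries (Fin n) κ) :=
  sup_le (Ideal.span_le.mpr (by rintro _ ⟨s, rfl⟩; exact pderiv_mem_maximalIdeal hf s))
    (Ideal.pow_le_self hk)

/-! ## Step A: two linear forms generate `𝔪` modulo `(∂f) + 𝔪²` when `dim R/((∂f)+𝔪²) = 3` -/

/-- [OURS · L1 W4.6] **Corank two gives two linear generators**: if `f` has no linear terms and
`jetTwoColength f = 3` (`e = 2`), there are two LINEAR FORMS `x = Σ aₛXₛ`, `y = Σ bₛXₛ` such that every
`m ∈ 𝔪` is `≡ αx + βy` modulo `(∂f) + 𝔪²`. (The classes of the `Xₛ` span a subspace of `R/((∂f)+𝔪²)`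
missing `[1]`, hence of dimension `≤ 2`.) [folklore] -/
theorem exists_linear_pair_of_jetTwoColength_eq_three {f : MvPowerSeries (Fin n) κ}
    (hf : ∀ s, coeff (Finsupp.single s 1) f = 0) (h3 : jetTwoColength f = 3) :
    ∃ a b : Fin n → κ, ∀ m ∈ maximalIdeal (MvPowerSeries (Fin n) κ), ∃ α β : κ,
      m - (C α * (∑ s, C (a s) * X s) + C β * (∑ s, C (b s) * X s)) ∈
        Ideal.span (Set.range fun s => MvPowerSeries.pderiv s f) ⊔
          maximalIdeal (MvPowerSeries (Fin n) κ) ^ 2 := by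
  set I := Ideal.span (Set.range fun s => MvPowerSeries.pderiv s f) ⊔
    maximalIdeal (MvPowerSeries (Fin n) κ) ^ 2 with hI
  have hfr : Module.finrank κ (MvPowerSeries (Fin n) κ ⧸ I) = 3 := h3
  haveI : Module.Finite κ (MvPowerSeries (Fin n) κ ⧸ I) := Module.finite_of_finrank_pos (by omega)
  set U : Submodule κ (MvPowerSeries (Fin n) κ ⧸ I) :=
    Submodule.span κ (Set.range fun s : Fin n => Ideal.Quotient.mk I (X s)) with hU
  have hIm : I ≤ maximalIdeal (MvPowerSeries (Fin n) κ) := jac_sup_pow_le_maximalIdeal hf two_ne_zero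
  -- linear forms map into `U`
  have hlinU : ∀ a : Fin n → κ, Ideal.Quotient.mk I (∑ s, C (a s) * X s) ∈ U := by
    intro a
    rw [map_sum]
    refine Submodule.sum_mem _ fun s _ => ?_
    rw [mk_C_mul]
    exact Submodule.smul_mem _ _ (Submodule.subset_span ⟨s, rfl⟩)
  -- every `m ∈ 𝔪` maps into `U`
  have hmU : ∀ m ∈ maximalIdeal (MvPowerSeries (Fin n) κ), Ideal.Quotient.mk I m ∈ U := by
    intro m hm
    have hm0 := Literature.RingTheory.MvPowerSeries.Jets.mem_maximalIdeal_iff_constantCoeff_eq_zero.mp hm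
    have heq : Ideal.Quotient.mk I m =
        Ideal.Quotient.mk I (∑ s, C (coeff (Finsupp.single s 1) m) * (X s : MvPowerSeries (Fin n) κ)) := by
      refine Ideal.Quotient.eq.mpr (Ideal.mem_sup_right ?_)
      have h := sub_linearPart_mem_maximalIdeal_sq hm0
      simp only [smul_eq_C_mul] at h
      exact h
    rw [heq]
    exact hlinU _
  -- `[1] ∉ U`, so `U` is a proper subspace
  have hU1 : Ideal.Quotient.mk I 1 ∉ U := by
    intro h1
    obtain ⟨a, ha⟩ := (Submodule.mem_span_range_iff_exists_fun κ).mp h1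
    have ha' : Ideal.Quotient.mk I (∑ s, C (a s) * X s) = Ideal.Quotient.mk I 1 := by
      rw [← ha, map_sum]
      exact Finset.sum_congr rfl fun s _ => mk_C_mul I (a s) (X s)
    have hmem : (∑ s, C (a s) * (X s : MvPowerSeries (Fin n) κ)) - 1 ∈
        maximalIdeal (MvPowerSeries (Fin n) κ) := hIm (Ideal.Quotient.eq.mp ha')
    have h0 := Literature.RingTheory.MvPowerSeries.Jets.mem_maximalIdeal_iff_constantCoeff_eq_zero.mp hmem
    have h0' := Literature.RingTheory.MvPowerSeries.Jets.mem_maximalIdeal_iff_constantCoeff_eq_zero.mp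
      (sum_C_mul_X_mem_maximalIdeal (n := n) a)
    rw [map_sub, h0', map_one, zero_sub, neg_eq_zero] at h0
    exact one_ne_zero h0
  have hUlt : U < ⊤ := lt_top_iff_ne_top.mpr fun h => hU1 (h ▸ Submodule.mem_top)
  have hfrU : Module.finrank κ U ≤ 2 := by
    have h1 := Submodule.finrank_lt_finrank_of_lt hUlt
    rw [finrank_top, hfr] at h1
    omega
  obtain ⟨xq, hxq, yq, hyq, hspan⟩ := exists_pair_span_of_finrank_le_two U hfrU
  obtain ⟨a, ha⟩ := (Submodule.mem_span_range_iff_exists_fun κ).mp hxq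
  obtain ⟨b, hb⟩ := (Submodule.mem_span_range_iff_exists_fun κ).mp hyq
  have ha' : Ideal.Quotient.mk I (∑ s, C (a s) * X s) = xq := by
    rw [← ha, map_sum]
    exact Finset.sum_congr rfl fun s _ => mk_C_mul I (a s) (X s)
  have hb' : Ideal.Quotient.mk I (∑ s, C (b s) * X s) = yq := by
    rw [← hb, map_sum]
    exact Finset.sum_congr rfl fun s _ => mk_C_mul I (b s) (X s)
  refine ⟨a, b, fun m hm => ?_⟩
  obtain ⟨α, β, hαβ⟩ := hspan _ (hmU m hm)
  refine ⟨α, β, ?_⟩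
  rw [← Ideal.Quotient.eq, map_add, mk_C_mul, mk_C_mul, ha', hb']
  exact hαβ

/-! ## Step B: `x², xy, y²` generate `𝔪²` modulo `𝔪·(∂f) + 𝔪³` -/

/-- [OURS · L1 W4.6] **Three quadratic generators**: if `x, y ∈ 𝔪` generate `𝔪` modulo `(∂f) + 𝔪²`,
then every `q ∈ 𝔪²` is `≡ αx² + βxy + γy²` modulo `𝔪·(∂f) + 𝔪³`. (`𝔪² = 𝔪·𝔪`; for `m = ℓ + r`,
`m' = ℓ' + r'` with `ℓ, ℓ'` in the span of `x, y` and `r, r' ∈ (∂f) + 𝔪²`: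
`mm' − ℓℓ' = r m' + ℓ r' ∈ 𝔪·(∂f) + 𝔪³`.) [folklore] -/
theorem exists_quadratic_coeffs {f : MvPowerSeries (Fin n) κ} {x y : MvPowerSeries (Fin n) κ}
    (hx : x ∈ maximalIdeal (MvPowerSeries (Fin n) κ)) (hy : y ∈ maximalIdeal (MvPowerSeries (Fin n) κ))
    (hgen : ∀ m ∈ maximalIdeal (MvPowerSeries (Fin n) κ), ∃ α β : κ,
      m - (C α * x + C β * y) ∈ Ideal.span (Set.range fun s => MvPowerSeries.pderiv s f) ⊔
        maximalIdeal (MvPowerSeries (Fin n) κ) ^ 2)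
    {q : MvPowerSeries (Fin n) κ} (hq : q ∈ maximalIdeal (MvPowerSeries (Fin n) κ) ^ 2) :
    ∃ α β γ : κ, q - (C α * x ^ 2 + C β * (x * y) + C γ * y ^ 2) ∈
      maximalIdeal (MvPowerSeries (Fin n) κ) * Ideal.span (Set.range fun s => MvPowerSeries.pderiv s f) ⊔
        maximalIdeal (MvPowerSeries (Fin n) κ) ^ 3 := by
  set 𝔪 := maximalIdeal (MvPowerSeries (Fin n) κ) with h𝔪
  set J := Ideal.span (Set.range fun s => MvPowerSeries.pderiv s f) with hJ
  rw [pow_two] at hq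
  refine Submodule.mul_induction_on hq (fun m hm m' hm' => ?_) (fun q₁ q₂ h₁ h₂ => ?_)
  · obtain ⟨α, β, hr⟩ := hgen m hm
    obtain ⟨α', β', hr'⟩ := hgen m' hm'
    have hℓ : C α * x + C β * y ∈ 𝔪 :=
      Ideal.add_mem _ (Ideal.mul_mem_left _ _ hx) (Ideal.mul_mem_left _ _ hy)
    refine ⟨α * α', α * β' + β * α', β * β', ?_⟩
    have key : m * m' - (C (α * α') * x ^ 2 + C (α * β' + β * α') * (x * y) + C (β * β') * y ^ 2) =
        (m - (C α * x + C β * y)) * m' + (C α * x + C β * y) * (m' - (C α' * x + C β' * y)) := by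
      simp only [map_add, map_mul]
      ring
    rw [key]
    refine Ideal.add_mem _ ?_ ?_
    · obtain ⟨j, hj, q₂, hq₂, hjq⟩ := Submodule.mem_sup.mp hr
      rw [← hjq, add_mul]
      refine Ideal.add_mem _ (Ideal.mem_sup_left (Submodule.mul_mem_mul_rev hm' hj)) (Ideal.mem_sup_right ?_)
      rw [pow_succ]
      exact Ideal.mul_mem_mul hq₂ hm'
    · obtain ⟨j', hj', q', hq', hjq'⟩ := Submodule.mem_sup.mp hr'
      rw [← hjq', mul_add]
      refine Ideal.add_mem _ (Ideal.mem_sup_left (Ideal.mul_mem_mul hℓ hj')) (Ideal.mem_sup_right ?_)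
      rw [pow_succ']
      exact Ideal.mul_mem_mul hℓ hq'
  · obtain ⟨α₁, β₁, γ₁, h₁'⟩ := h₁
    obtain ⟨α₂, β₂, γ₂, h₂'⟩ := h₂
    refine ⟨α₁ + α₂, β₁ + β₂, γ₁ + γ₂, ?_⟩
    have key : q₁ + q₂ - (C (α₁ + α₂) * x ^ 2 + C (β₁ + β₂) * (x * y) + C (γ₁ + γ₂) * y ^ 2) =
        (q₁ - (C α₁ * x ^ 2 + C β₁ * (x * y) + C γ₁ * y ^ 2)) +
          (q₂ - (C α₂ * x ^ 2 + C β₂ * (x * y) + C γ₂ * y ^ 2)) := by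
      simp only [map_add]
      ring
    rw [key]
    exact Ideal.add_mem _ h₁' h₂'

/-- [OURS · L1 W4.6] `𝔪·(∂f) + 𝔪³ ≤ (∂f) + 𝔪³`. [folklore] -/
theorem maximalIdeal_mul_jac_sup_le (f : MvPowerSeries (Fin n) κ) :
    maximalIdeal (MvPowerSeries (Fin n) κ) * Ideal.span (Set.range fun s => MvPowerSeries.pderiv s f) ⊔
        maximalIdeal (MvPowerSeries (Fin n) κ) ^ 3 ≤
      Ideal.span (Set.range fun s => MvPowerSeries.pderiv s f) ⊔ maximalIdeal (MvPowerSeries (Fin n) κ) ^ 3 :=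
  sup_le_sup_right Ideal.mul_le_left _

/-! ## Step C: the six classes `1, x, y, x², xy, y²` span `R/((∂f)+𝔪³)` -/

/-- [OURS · L1 W4.6] **Six spanning classes**: with `x, y` as in Step A, the classes of
`1, x, y, x², xy, y²` span `R/((∂f) + 𝔪³)`. [folklore] -/
theorem top_le_span_six {f : MvPowerSeries (Fin n) κ} {x y : MvPowerSeries (Fin n) κ}
    (hx : x ∈ maximalIdeal (MvPowerSeries (Fin n) κ)) (hy : y ∈ maximalIdeal (MvPowerSeries (Fin n) κ))
    (hgen : ∀ m ∈ maximalIdeal (MvPowerSeries (Fin n) κ), ∃ α β : κ,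
      m - (C α * x + C β * y) ∈ Ideal.span (Set.range fun s => MvPowerSeries.pderiv s f) ⊔
        maximalIdeal (MvPowerSeries (Fin n) κ) ^ 2) :
    ⊤ ≤ Submodule.span κ (Set.range
      ![Ideal.Quotient.mk (Ideal.span (Set.range fun s => MvPowerSeries.pderiv s f) ⊔
          maximalIdeal (MvPowerSeries (Fin n) κ) ^ 3) 1,
        Ideal.Quotient.mk (Ideal.span (Set.range fun s => MvPowerSeries.pderiv s f) ⊔
          maximalIdeal (MvPowerSeries (Fin n) κ) ^ 3) x,
        Ideal.Quotient.mk (Ideal.span (Set.range fun s => MvPowerSeries.pderiv s f) ⊔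
          maximalIdeal (MvPowerSeries (Fin n) κ) ^ 3) y,
        Ideal.Quotient.mk (Ideal.span (Set.range fun s => MvPowerSeries.pderiv s f) ⊔
          maximalIdeal (MvPowerSeries (Fin n) κ) ^ 3) (x ^ 2),
        Ideal.Quotient.mk (Ideal.span (Set.range fun s => MvPowerSeries.pderiv s f) ⊔
          maximalIdeal (MvPowerSeries (Fin n) κ) ^ 3) (x * y),
        Ideal.Quotient.mk (Ideal.span (Set.range fun s => MvPowerSeries.pderiv s f) ⊔
          maximalIdeal (MvPowerSeries (Fin n) κ) ^ 3) (y ^ 2)]) := by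
  set I3 := Ideal.span (Set.range fun s => MvPowerSeries.pderiv s f) ⊔
    maximalIdeal (MvPowerSeries (Fin n) κ) ^ 3 with hI3
  set S := Submodule.span κ (Set.range ![Ideal.Quotient.mk I3 1, Ideal.Quotient.mk I3 x,
    Ideal.Quotient.mk I3 y, Ideal.Quotient.mk I3 (x ^ 2), Ideal.Quotient.mk I3 (x * y),
    Ideal.Quotient.mk I3 (y ^ 2)]) with hS
  have h0 : Ideal.Quotient.mk I3 1 ∈ S := Submodule.subset_span ⟨0, rfl⟩
  have h1 : Ideal.Quotient.mk I3 x ∈ S := Submodule.subset_span ⟨1, rfl⟩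
  have h2 : Ideal.Quotient.mk I3 y ∈ S := Submodule.subset_span ⟨2, rfl⟩
  have h3 : Ideal.Quotient.mk I3 (x ^ 2) ∈ S := Submodule.subset_span ⟨3, rfl⟩
  have h4 : Ideal.Quotient.mk I3 (x * y) ∈ S := Submodule.subset_span ⟨4, rfl⟩
  have h5 : Ideal.Quotient.mk I3 (y ^ 2) ∈ S := Submodule.subset_span ⟨5, rfl⟩
  -- quadratic elements
  have hquad : ∀ q ∈ maximalIdeal (MvPowerSeries (Fin n) κ) ^ 2, Ideal.Quotient.mk I3 q ∈ S := by
    intro q hq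
    obtain ⟨α, β, γ, hαβγ⟩ := exists_quadratic_coeffs hx hy hgen hq
    have heq : Ideal.Quotient.mk I3 q =
        Ideal.Quotient.mk I3 (C α * x ^ 2 + C β * (x * y) + C γ * y ^ 2) :=
      Ideal.Quotient.eq.mpr (maximalIdeal_mul_jac_sup_le f hαβγ)
    rw [heq, map_add, map_add, mk_C_mul, mk_C_mul, mk_C_mul]
    exact Submodule.add_mem _ (Submodule.add_mem _ (Submodule.smul_mem _ _ h3)
      (Submodule.smul_mem _ _ h4)) (Submodule.smul_mem _ _ h5)
  -- elements of the maximal ideal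
  have hmax : ∀ m ∈ maximalIdeal (MvPowerSeries (Fin n) κ), Ideal.Quotient.mk I3 m ∈ S := by
    intro m hm
    obtain ⟨α, β, hr⟩ := hgen m hm
    obtain ⟨j, hj, q, hq, hjq⟩ := Submodule.mem_sup.mp hr
    have hm' : m = C α * x + C β * y + j + q := by rw [add_assoc, hjq]; ring
    rw [hm', map_add, map_add, map_add, mk_C_mul, mk_C_mul,
      Ideal.Quotient.eq_zero_iff_mem.mpr (Ideal.mem_sup_left hj : j ∈ I3), add_zero]
    exact Submodule.add_mem _ (Submodule.add_mem _ (Submodule.smul_mem _ _ h1)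
      (Submodule.smul_mem _ _ h2)) (hquad q hq)
  -- everything
  intro v _
  obtain ⟨r, rfl⟩ := Ideal.Quotient.mk_surjective v
  have hsplit : r = C (constantCoeff r) * 1 + (r - C (constantCoeff r)) := by ring
  have hrm : r - C (constantCoeff r) ∈ maximalIdeal (MvPowerSeries (Fin n) κ) := by
    rw [Literature.RingTheory.MvPowerSeries.Jets.mem_maximalIdeal_iff_constantCoeff_eq_zero, map_sub,
      constantCoeff_C, sub_self]
  rw [hsplit, map_add, mk_C_mul]
  exact Submodule.add_mem _ (Submodule.smul_mem _ _ h0) (hmax _ hrm)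

/-! ## Step D: `dim R/((∂f)+𝔪³) = 6` forces the directional derivatives along the kernel into `𝔪·(∂f) + 𝔪³` -/

/-- [OURS · L1 W4.6] **If the six classes span a space of dimension `6`, an element of `(∂f)` congruent
to `αx² + βxy + γy²` modulo `𝔪·(∂f) + 𝔪³` lies in `𝔪·(∂f) + 𝔪³`** (the six classes are independent,
and `αx² + βxy + γy² ∈ (∂f) + 𝔪³` forces `α = β = γ = 0`). [folklore] -/
theorem mem_maximalIdeal_mul_jac_of_jetThree_eq_six {f : MvPowerSeries (Fin n) κ}
    {x y : MvPowerSeries (Fin n) κ}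
    (hx : x ∈ maximalIdeal (MvPowerSeries (Fin n) κ)) (hy : y ∈ maximalIdeal (MvPowerSeries (Fin n) κ))
    (hgen : ∀ m ∈ maximalIdeal (MvPowerSeries (Fin n) κ), ∃ α β : κ,
      m - (C α * x + C β * y) ∈ Ideal.span (Set.range fun s => MvPowerSeries.pderiv s f) ⊔
        maximalIdeal (MvPowerSeries (Fin n) κ) ^ 2)
    (h6 : jetThreeColength f = 6) {D : MvPowerSeries (Fin n) κ}
    (hD : D ∈ Ideal.span (Set.range fun s => MvPowerSeries.pderiv s f))
    (hD2 : D ∈ maximalIdeal (MvPowerSeries (Fin n) κ) ^ 2) :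
    D ∈ maximalIdeal (MvPowerSeries (Fin n) κ) * Ideal.span (Set.range fun s => MvPowerSeries.pderiv s f) ⊔
      maximalIdeal (MvPowerSeries (Fin n) κ) ^ 3 := by
  set I3 := Ideal.span (Set.range fun s => MvPowerSeries.pderiv s f) ⊔
    maximalIdeal (MvPowerSeries (Fin n) κ) ^ 3 with hI3
  set v : Fin 6 → MvPowerSeries (Fin n) κ ⧸ I3 := ![Ideal.Quotient.mk I3 1, Ideal.Quotient.mk I3 x,
    Ideal.Quotient.mk I3 y, Ideal.Quotient.mk I3 (x ^ 2), Ideal.Quotient.mk I3 (x * y),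
    Ideal.Quotient.mk I3 (y ^ 2)] with hv
  have hfr : Module.finrank κ (MvPowerSeries (Fin n) κ ⧸ I3) = 6 := h6
  have hli : LinearIndependent κ v :=
    linearIndependent_of_top_le_span_of_card_eq_finrank (top_le_span_six hx hy hgen) (by rw [hfr]; rfl)
  obtain ⟨α, β, γ, hq⟩ := exists_quadratic_coeffs hx hy hgen hD2
  -- the quadratic combination lies in `(∂f) + 𝔪³`
  have hQ : C α * x ^ 2 + C β * (x * y) + C γ * y ^ 2 ∈ I3 := by
    have h := Ideal.sub_mem _ (Ideal.mem_sup_left hD : D ∈ I3) (maximalIdeal_mul_jac_sup_le f hq)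
    rwa [sub_sub_cancel] at h
  -- read it as a linear relation among the six classes
  have hrel : ∑ i, (![0, 0, 0, α, β, γ] : Fin 6 → κ) i • v i = 0 := by
    rw [Fin.sum_univ_six]
    simp only [hv, Matrix.cons_val_zero, Matrix.cons_val_one, Matrix.cons_val]
    rw [zero_smul, zero_smul, zero_smul, zero_add, zero_add, zero_add, ← mk_C_mul, ← mk_C_mul, ← mk_C_mul,
      ← map_add, ← map_add]
    exact Ideal.Quotient.eq_zero_iff_mem.mpr hQ
  have hcoef := Fintype.linearIndependent_iff.mp hli _ hrel
  have hα : α = 0 := hcoef 3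
  have hβ : β = 0 := hcoef 4
  have hγ : γ = 0 := hcoef 5
  rw [hα, hβ, hγ, map_zero, zero_mul, zero_mul, zero_mul, add_zero, add_zero, sub_zero] at hq
  exact hq

/-- [OURS · L1 W4.6] **`e = 2` and `dim R/((∂f)+𝔪³) = 6` ⇒ every directional derivative along a kernel
vector lies in `𝔪·(∂f) + 𝔪³`** (characteristic two; `λ · P = 0`). [folklore] -/
theorem sum_C_mul_pderiv_mem_of_jetThree_eq_six [CharP κ 2] {f : MvPowerSeries (Fin n) κ} (hf : 2 ≤ f.order)
    (h3 : jetTwoColength f = 3) (h6 : jetThreeColength f = 6) {lam : Fin n → κ}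
    (hlam : Matrix.vecMul lam (polarMatrix f) = 0) :
    ∑ s, C (lam s) * MvPowerSeries.pderiv s f ∈
      maximalIdeal (MvPowerSeries (Fin n) κ) * Ideal.span (Set.range fun s => MvPowerSeries.pderiv s f) ⊔
        maximalIdeal (MvPowerSeries (Fin n) κ) ^ 3 := by
  have hf' := ((FormalCoordChange.two_le_order_iff f).mp hf).2
  obtain ⟨a, b, hgen⟩ := exists_linear_pair_of_jetTwoColength_eq_three hf' h3
  exact mem_maximalIdeal_mul_jac_of_jetThree_eq_six (sum_C_mul_X_mem_maximalIdeal a)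
    (sum_C_mul_X_mem_maximalIdeal b) hgen h6 (sum_C_mul_pderiv_mem_jac f lam)
    (sum_C_mul_pderiv_mem_maximalIdeal_sq hf hlam)


end CampaignW46.HypersurfacesCharTwo

end Summit.ResolutionOfSingularities.ResolutionOfSingularities.Theorems

end
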